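import Mathlib
import Summits.Ventures.PercRepro2.TypedLocusPieces
import Summits.Ventures.PercRepro2.TypedBlockTransfer

/-!
# From the fibre theorems to the class sum: the block-transfer rule for typed counts (blind cell
PercRepro2, mine-2 g37, 2026-08-28; `proofs/MINE2-FIBRE.md` §1b–§2, row M2-77)

Twice the typed count of `K₃` is the typed count of the three PD-gated pieces
(`two_mul_typedCount_eq_pieces`); regrouped by the spectator copy `x` (night-3's
`typedCount_eq_sum_spec`) each spectator contributes the complementary-pair count of its pieces on
its fibre `(specFree F τ x, specPin F z τ x)`.  Under

* `H3`: in every PD spectator's fibre `a₃` is attached to a root by the forced-open edges (so no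
  other copy is PD: the two-PD piece and the `σ₃`-piece vanish pointwise), and
* `HW`: every PD spectator's fibre carries a block `W` (`BlockData`) containing `b` but not `o, a₃`,
  or containing `o, a₃` but not `b`,

the piece `1_PD(x) · 1_Q(y) 1_Q(w) (F(w) − F(y)) (σ_b(w) − σ_b(y))` is killed by the block transfer
(`pinnedCount_blockTransfer_b / _o`), and the typed count vanishes (`typedCount_eq_zero_of_blocks`).
This is the class-level form of the rule the census verifies fibre by fibre.

Own code; standard axioms.
-/

namespace Summit.Ventures.PercRepro2

open UnionCluster

namespace CovForm

namespace LocusBridge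

open OneTyped TypedA3 BlockTransfer

section Bridge

open Classical

variable {V : Type*} {E : Type*} [Fintype E] [DecidableEq E] {R : Type*} [Field R]
  [LinearOrder R] [IsStrictOrderedRing R]
variable (ends : E → Sym2 V) (o a₁ a₂ a₃ b : V)

/-! ## The state functions of a configuration -/

omit [Fintype E] [DecidableEq E] [LinearOrder R] [IsStrictOrderedRing R] in
/-- `1_Q` on the state of a configuration. -/
lemma qB_st (ω : Config E) :
    qB (st ends o a₁ a₂ a₃ b ω) = if Conn ends ω a₂ a₁ then 0 else 1 := by
  simp [qB, st, St.q']

omit [Fintype E] [DecidableEq E] [LinearOrder R] [IsStrictOrderedRing R] in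
/-- `1_PD` on the state of a configuration. -/
lemma pdB_st (ω : Config E) :
    pdB (st ends o a₁ a₂ a₃ b ω) =
      if Conn ends ω a₂ a₁ then 0 else if Conn ends ω a₁ a₃ ∨ Conn ends ω a₂ a₃ then 0 else 1 := by
  simp [pdB, st, St.q', St.L3, St.H3]

omit [Fintype E] [DecidableEq E] [LinearOrder R] [IsStrictOrderedRing R] in
/-- `σ₃` on the state of a configuration. -/
lemma s3s_st (ω : Config E) :
    s3s (st ends o a₁ a₂ a₃ b ω) =
      (if Conn ends ω a₁ a₃ then 1 else 0) - (if Conn ends ω a₂ a₃ then 1 else 0) := by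
  simp [s3s, sigB, st, St.L3, St.H3]

omit [Fintype E] [DecidableEq E] [LinearOrder R] [IsStrictOrderedRing R] in
/-- `σ_b` on the state of a configuration, cast to `R`. -/
lemma sbs_st (ω : Config E) :
    ((sbs (st ends o a₁ a₂ a₃ b ω) : ℤ) : R) = sigma ends a₁ a₂ b ω := by
  simp [sbs, sigB, st, St.Lb, St.Hb, sigma, iL, iH, Set.indicator_apply, mem_connEvent]

omit [Fintype E] [DecidableEq E] [LinearOrder R] [IsStrictOrderedRing R] in
/-- `F = σ_o − σ₃ 1_{o∈U}` on the state of a configuration, cast to `R`. -/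
lemma Fs_st (ω : Config E) :
    ((Fs (st ends o a₁ a₂ a₃ b ω) : ℤ) : R) =
      sigma ends a₁ a₂ o ω - sigma ends a₁ a₂ a₃ ω * inU ends a₁ a₂ o ω := by
  simp [Fs, sigB, uB, st, St.Lo, St.Ho, St.L3, St.H3, sigma, inU, iL, iH, Set.indicator_apply,
    mem_connEvent]

omit [Fintype E] [DecidableEq E] [LinearOrder R] [IsStrictOrderedRing R] in
/-- `1_Q` on the state, cast to `R`, is `iQ`. -/
lemma qB_st_cast (ω : Config E) : ((qB (st ends o a₁ a₂ a₃ b ω) : ℤ) : R) = iQ ends a₁ a₂ ω := by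
  rw [qB_st, iQ_eq_ite']
  split_ifs <;> simp

omit [Fintype E] [DecidableEq E] [LinearOrder R] [IsStrictOrderedRing R] in
/-- A configuration with `a₃` in a root cluster has `1_PD = 0`. -/
lemma pdB_st_eq_zero (ω : Config E) (h : Conn ends ω a₃ a₁ ∨ Conn ends ω a₃ a₂) :
    pdB (st ends o a₁ a₂ a₃ b ω) = 0 := by
  rw [pdB_st]
  rcases h with h | h
  · have : Conn ends ω a₁ a₃ ∨ Conn ends ω a₂ a₃ := Or.inl (conn_symm h)
    split_ifs <;> simp_all
  · have : Conn ends ω a₁ a₃ ∨ Conn ends ω a₂ a₃ := Or.inr (conn_symm h)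
    split_ifs <;> simp_all

omit [Fintype E] [DecidableEq E] [LinearOrder R] [IsStrictOrderedRing R] in
/-- A nonzero `1_PD` means `Q` and `PD`. -/
lemma pd_of_pdB_ne_zero (ω : Config E) (h : pdB (st ends o a₁ a₂ a₃ b ω) ≠ 0) :
    ¬ Conn ends ω a₂ a₁ ∧ ¬ Conn ends ω a₁ a₃ ∧ ¬ Conn ends ω a₂ a₃ := by
  rw [pdB_st] at h
  by_cases h1 : Conn ends ω a₂ a₁
  · simp [h1] at h
  by_cases h2 : Conn ends ω a₁ a₃ ∨ Conn ends ω a₂ a₃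
  · simp [h1, h2] at h
  · exact ⟨h1, fun h' => h2 (Or.inl h'), fun h' => h2 (Or.inr h')⟩

omit [Fintype E] [DecidableEq E] [LinearOrder R] [IsStrictOrderedRing R] in
/-- Two copies with `Q` in which `a₃` is joined to the same root have the same `σ₃`. -/
lemma s3s_st_eq (x w : Config E) (hx : ¬ Conn ends x a₂ a₁) (hw : ¬ Conn ends w a₂ a₁) {r : V}
    (hr : r = a₁ ∨ r = a₂) (h1 : Conn ends x a₃ r) (h2 : Conn ends w a₃ r) :
    s3s (st ends o a₁ a₂ a₃ b x) = s3s (st ends o a₁ a₂ a₃ b w) := by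
  rw [s3s_st, s3s_st]
  rcases hr with hr | hr
  · rw [hr] at h1 h2
    have hx1 : Conn ends x a₁ a₃ := conn_symm h1
    have hw1 : Conn ends w a₁ a₃ := conn_symm h2
    have hx2 : ¬ Conn ends x a₂ a₃ := fun h => hx (conn_trans h (conn_symm hx1))
    have hw2 : ¬ Conn ends w a₂ a₃ := fun h => hw (conn_trans h (conn_symm hw1))
    rw [if_pos hx1, if_pos hw1, if_neg hx2, if_neg hw2]
  · rw [hr] at h1 h2
    have hx2 : Conn ends x a₂ a₃ := conn_symm h1
    have hw2 : Conn ends w a₂ a₃ := conn_symm h2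
    have hx1 : ¬ Conn ends x a₁ a₃ := fun h => hx (conn_trans hx2 (conn_symm h))
    have hw1 : ¬ Conn ends w a₁ a₃ := fun h => hw (conn_trans hw2 (conn_symm h))
    rw [if_neg hx1, if_neg hw1, if_pos hx2, if_pos hw2]

/-! ## The spectator's fibre -/

omit [Fintype E] [LinearOrder R] [IsStrictOrderedRing R] in
/-- A copy of the spectator's fibre agrees with `z` off `F`. -/
lemma agree_of_fibre (F : Finset E) (z : Config E) (τ : E → ℕ) (x y : Config E)
    (hy : ∀ e, e ∉ specFree F τ x → y e = specPin F z τ x e) : ∀ e, e ∉ F → y e = z e := by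
  intro e he
  rw [hy e (fun h => he (specFree_subset F τ x h)), specPin_of_notMem he]

omit [Fintype E] [LinearOrder R] [IsStrictOrderedRing R] in
/-- The forced-open configuration of the spectator lies below both copies of a pair. -/
lemma specPin_le_pair (F : Finset E) (z : Config E) (τ : E → ℕ) (x y : Config E)
    (hy : ∀ e, e ∉ specFree F τ x → y e = specPin F z τ x e) :
    specPin F z τ x ≤ y ∧ specPin F z τ x ≤ flipOn (specFree F τ x) y := by
  constructor
  · intro e
    by_cases he : e ∈ specFree F τ x
    · have h1 : τ e = (x e).toNat + 1 := (mem_specFree.1 he).2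
      have h2 : specPin F z τ x e = false := by
        rw [specPin_of_mem (specFree_subset F τ x he)]
        simp [h1]
      rw [h2]; exact Bool.false_le _
    · rw [hy e he]
  · intro e
    by_cases he : e ∈ specFree F τ x
    · have h1 : τ e = (x e).toNat + 1 := (mem_specFree.1 he).2
      have h2 : specPin F z τ x e = false := by
        rw [specPin_of_mem (specFree_subset F τ x he)]
        simp [h1]
      rw [h2]; exact Bool.false_le _
    · rw [flipOn_of_notMem _ _ he, hy e he]

omit [Fintype E] [LinearOrder R] [IsStrictOrderedRing R] in
/-- The forced-open configuration of a pair copy `y` lies below the spectator and the other copy: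
an edge both `x` and `w` must carry is open in both. -/
lemma specPin_pair_le (F : Finset E) (z : Config E) (τ : E → ℕ) (hτ : ∀ e ∈ F, τ e = 1 ∨ τ e = 2)
    (x y : Config E) (hx : ∀ e, e ∉ F → x e = z e)
    (hy : ∀ e, e ∉ specFree F τ x → y e = specPin F z τ x e) :
    specPin F z τ y ≤ x ∧ specPin F z τ y ≤ flipOn (specFree F τ x) y := by
  have key : ∀ e, specPin F z τ y e = true → x e = true ∧ flipOn (specFree F τ x) y e = true := by
    intro e he
    by_cases heF : e ∈ F
    · rw [specPin_of_mem heF] at he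
      have hτe : τ e = (y e).toNat + 2 := by simpa using he
      have hy0 : y e = false := by
        have ht : (y e).toNat = 0 := by rcases hτ e heF with h | h <;> omega
        exact Bool.toNat_eq_zero.1 ht
      have hτ2 : τ e = 2 := by rw [hτe, hy0]; rfl
      by_cases heG : e ∈ specFree F τ x
      · have h1 : τ e = (x e).toNat + 1 := (mem_specFree.1 heG).2
        have hx1 : x e = true := by
          have ht : (x e).toNat = 1 := by omega
          exact Bool.toNat_eq_one.1 ht
        refine ⟨hx1, ?_⟩
        rw [flipOn_of_mem _ _ heG, hy0]; rfl
      · exfalso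
        have := hy e heG
        rw [specPin_of_mem heF] at this
        rw [hy0] at this
        have hne : ¬ τ e = (x e).toNat + 2 := by simpa using this.symm
        have hne' : ¬ τ e = (x e).toNat + 1 := fun h => heG (mem_specFree.2 ⟨heF, h⟩)
        have ht : (x e).toNat = 0 ∨ (x e).toNat = 1 := by cases x e <;> simp
        omega
    · rw [specPin_of_notMem heF] at he
      have hG : e ∉ specFree F τ x := fun h => heF (specFree_subset F τ x h)
      refine ⟨by rw [hx e heF]; exact he, ?_⟩
      rw [flipOn_of_notMem _ _ hG, hy e hG, specPin_of_notMem heF]; exact he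
  constructor
  · intro e
    cases h : specPin F z τ y e
    · exact Bool.false_le _
    · rw [(key e h).1]
  · intro e
    cases h : specPin F z τ y e
    · exact Bool.false_le _
    · rw [(key e h).2]

/-! ## The pieces on a fibre -/

/-- The first piece as a configuration kernel on a pair, given the spectator. -/
noncomputable def Fc (ω : Config E) : R :=
  sigma ends a₁ a₂ o ω - sigma ends a₁ a₂ a₃ ω * inU ends a₁ a₂ o ω

omit [Fintype E] [LinearOrder R] [IsStrictOrderedRing R] in
/-- **On the fibre of a spectator, the three pieces reduce to the first**: with `a₃` root-attached in
every PD copy's forced-open configuration, the `σ₃`-piece and the two-PD piece vanish pointwise. -/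
lemma Dc_eq_on_fibre (F : Finset E) (z : Config E) (τ : E → ℕ) (hτ : ∀ e ∈ F, τ e = 1 ∨ τ e = 2)
    (H3 : ∀ x : Config E, (∀ e, e ∉ F → x e = z e) → ¬ Conn ends x a₂ a₁ → ¬ Conn ends x a₁ a₃ →
      ¬ Conn ends x a₂ a₃ → (Conn ends (specPin F z τ x) a₃ a₁ ∨ Conn ends (specPin F z τ x) a₃ a₂))
    (x : Config E) (hx : ∀ e, e ∉ F → x e = z e) (y : Config E)
    (hy : ∀ e, e ∉ specFree F τ x → y e = specPin F z τ x e) :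
    Dc ends o a₁ a₂ a₃ b x y (flipOn (specFree F τ x) y) =
      ((qB (st ends o a₁ a₂ a₃ b x) * pdB (st ends o a₁ a₂ a₃ b x) : ℤ) : R) *
        covW ends a₁ a₂ (Fc ends o a₁ a₂ a₃) (sigma ends a₁ a₂ b) y (flipOn (specFree F τ x) y) := by
  -- the `σ₃`-piece vanishes
  have hT2 : qB (st ends o a₁ a₂ a₃ b x) * qB (st ends o a₁ a₂ a₃ b y) *
      qB (st ends o a₁ a₂ a₃ b (flipOn (specFree F τ x) y)) *
      (pdB (st ends o a₁ a₂ a₃ b y) * uos (st ends o a₁ a₂ a₃ b y) *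
        (s3s (st ends o a₁ a₂ a₃ b (flipOn (specFree F τ x) y)) - s3s (st ends o a₁ a₂ a₃ b x)) *
        (sbs (st ends o a₁ a₂ a₃ b (flipOn (specFree F τ x) y)) - sbs (st ends o a₁ a₂ a₃ b x))) = 0 := by
    by_cases hpd : pdB (st ends o a₁ a₂ a₃ b y) = 0
    · rw [hpd]; ring
    · obtain ⟨hQy, h13, h23⟩ := pd_of_pdB_ne_zero ends o a₁ a₂ a₃ b y hpd
      have hy' : ∀ e, e ∉ F → y e = z e := agree_of_fibre F z τ x y hy
      obtain ⟨hle1, hle2⟩ := specPin_pair_le F z τ hτ x y hx hy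
      by_cases hQx : Conn ends x a₂ a₁
      · have : qB (st ends o a₁ a₂ a₃ b x) = 0 := by rw [qB_st]; simp [hQx]
        rw [this]; ring
      by_cases hQw : Conn ends (flipOn (specFree F τ x) y) a₂ a₁
      · have : qB (st ends o a₁ a₂ a₃ b (flipOn (specFree F τ x) y)) = 0 := by
          rw [qB_st]; simp [hQw]
        rw [this]; ring
      have hs : s3s (st ends o a₁ a₂ a₃ b x) = s3s (st ends o a₁ a₂ a₃ b (flipOn (specFree F τ x) y)) := by
        rcases H3 y hy' hQy h13 h23 with hr | hr
        · exact s3s_st_eq ends o a₁ a₂ a₃ b x _ hQx hQw (Or.inl rfl) (conn_mono hle1 hr)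
            (conn_mono hle2 hr)
        · exact s3s_st_eq ends o a₁ a₂ a₃ b x _ hQx hQw (Or.inr rfl) (conn_mono hle1 hr)
            (conn_mono hle2 hr)
      rw [hs]; ring
  -- the two-PD piece vanishes
  have hT3 : pdB (st ends o a₁ a₂ a₃ b x) * pdB (st ends o a₁ a₂ a₃ b (flipOn (specFree F τ x) y)) = 0 := by
    by_cases hpd : pdB (st ends o a₁ a₂ a₃ b x) = 0
    · rw [hpd]; ring
    · obtain ⟨hQx, h13, h23⟩ := pd_of_pdB_ne_zero ends o a₁ a₂ a₃ b x hpd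
      obtain ⟨-, hle⟩ := specPin_le_pair F z τ x y hy
      have : pdB (st ends o a₁ a₂ a₃ b (flipOn (specFree F τ x) y)) = 0 := by
        rcases H3 x hx hQx h13 h23 with hr | hr
        · exact pdB_st_eq_zero ends o a₁ a₂ a₃ b _ (Or.inl (conn_mono hle hr))
        · exact pdB_st_eq_zero ends o a₁ a₂ a₃ b _ (Or.inr (conn_mono hle hr))
      rw [this]; ring
  have hD : Dst (st ends o a₁ a₂ a₃ b x) (st ends o a₁ a₂ a₃ b y)
      (st ends o a₁ a₂ a₃ b (flipOn (specFree F τ x) y)) =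
      qB (st ends o a₁ a₂ a₃ b x) * pdB (st ends o a₁ a₂ a₃ b x) *
        (qB (st ends o a₁ a₂ a₃ b y) * qB (st ends o a₁ a₂ a₃ b (flipOn (specFree F τ x) y)) *
          (Fs (st ends o a₁ a₂ a₃ b (flipOn (specFree F τ x) y)) - Fs (st ends o a₁ a₂ a₃ b y)) *
          (sbs (st ends o a₁ a₂ a₃ b (flipOn (specFree F τ x) y)) - sbs (st ends o a₁ a₂ a₃ b y))) := by
    unfold Dst
    have e1 : qB (st ends o a₁ a₂ a₃ b x) * qB (st ends o a₁ a₂ a₃ b y) *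
        qB (st ends o a₁ a₂ a₃ b (flipOn (specFree F τ x) y)) *
        (pdB (st ends o a₁ a₂ a₃ b x) * pdB (st ends o a₁ a₂ a₃ b (flipOn (specFree F τ x) y)) *
          (uos (st ends o a₁ a₂ a₃ b (flipOn (specFree F τ x) y)) - uos (st ends o a₁ a₂ a₃ b x)) *
          (ubs (st ends o a₁ a₂ a₃ b (flipOn (specFree F τ x) y)) - ubs (st ends o a₁ a₂ a₃ b x))) = 0 := by
      rw [show pdB (st ends o a₁ a₂ a₃ b x) * pdB (st ends o a₁ a₂ a₃ b (flipOn (specFree F τ x) y)) *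
          (uos (st ends o a₁ a₂ a₃ b (flipOn (specFree F τ x) y)) - uos (st ends o a₁ a₂ a₃ b x)) *
          (ubs (st ends o a₁ a₂ a₃ b (flipOn (specFree F τ x) y)) - ubs (st ends o a₁ a₂ a₃ b x)) =
          (pdB (st ends o a₁ a₂ a₃ b x) * pdB (st ends o a₁ a₂ a₃ b (flipOn (specFree F τ x) y))) *
          ((uos (st ends o a₁ a₂ a₃ b (flipOn (specFree F τ x) y)) - uos (st ends o a₁ a₂ a₃ b x)) *
          (ubs (st ends o a₁ a₂ a₃ b (flipOn (specFree F τ x) y)) - ubs (st ends o a₁ a₂ a₃ b x))) by ring,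
        hT3]
      ring
    linear_combination hT2 - e1
  unfold Dc covW Fc
  rw [hD]
  push_cast
  simp only [qB_st_cast, sbs_st, Fs_st]

/-- **The block-transfer rule for typed counts.** -/
theorem typedCount_eq_zero_of_blocks (F : Finset E) (z : Config E) (τ : E → ℕ)
    (hτ : ∀ e ∈ F, τ e = 1 ∨ τ e = 2)
    (H3 : ∀ x : Config E, (∀ e, e ∉ F → x e = z e) → ¬ Conn ends x a₂ a₁ → ¬ Conn ends x a₁ a₃ →
      ¬ Conn ends x a₂ a₃ → (Conn ends (specPin F z τ x) a₃ a₁ ∨ Conn ends (specPin F z τ x) a₃ a₂))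
    (HW : ∀ x : Config E, (∀ e, e ∉ F → x e = z e) → ¬ Conn ends x a₂ a₁ → ¬ Conn ends x a₁ a₃ →
      ¬ Conn ends x a₂ a₃ → ∃ W : Finset V, BlockData ends a₁ a₂ W (specFree F τ x) (specPin F z τ x) ∧
        ((b ∈ W ∧ o ∉ W ∧ a₃ ∉ W) ∨ (o ∈ W ∧ a₃ ∈ W ∧ b ∉ W))) :
    typedCount F z τ (K3 ends o a₁ a₂ a₃ b : Config E → Config E → Config E → R) = 0 := by
  have h2 := two_mul_typedCount_eq_pieces (R := R) ends o a₁ a₂ a₃ b F z τ hτ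
  rw [typedCount_eq_sum_spec F z τ hτ (Dc ends o a₁ a₂ a₃ b : Config E → Config E → Config E → R)] at h2
  have hzero : ∀ x : Config E, (∀ e, e ∉ F → x e = z e) →
      pinnedCount (specFree F τ x) (specPin F z τ x) (Dc ends o a₁ a₂ a₃ b x : Config E → Config E → R) = 0 := by
    intro x hx
    have hcongr : pinnedCount (specFree F τ x) (specPin F z τ x) (Dc ends o a₁ a₂ a₃ b x : Config E → Config E → R) =
        pinnedCount (specFree F τ x) (specPin F z τ x) (fun y w =>
          ((qB (st ends o a₁ a₂ a₃ b x) * pdB (st ends o a₁ a₂ a₃ b x) : ℤ) : R) *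
            covW ends a₁ a₂ (Fc ends o a₁ a₂ a₃) (sigma ends a₁ a₂ b) y w) := by
      unfold pinnedCount
      refine Finset.sum_congr rfl fun y _ => ?_
      split_ifs with hy
      · exact Dc_eq_on_fibre ends o a₁ a₂ a₃ b F z τ hτ H3 x hx y hy
      · rfl
    rw [hcongr, pinnedCount_const_mul]
    by_cases hpd : pdB (st ends o a₁ a₂ a₃ b x) = 0
    · rw [hpd]; simp
    · obtain ⟨hQx, h13, h23⟩ := pd_of_pdB_ne_zero ends o a₁ a₂ a₃ b x hpd
      obtain ⟨W, hd, hW⟩ := HW x hx hQx h13 h23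
      have hzero' : pinnedCount (specFree F τ x) (specPin F z τ x)
          (covW ends a₁ a₂ (Fc ends o a₁ a₂ a₃) (sigma ends a₁ a₂ b) : Config E → Config E → R) = 0 := by
        rcases hW with ⟨hb, ho, h3⟩ | ⟨ho, h3, hb⟩
        · have h0 := pinnedCount_blockTransfer_b (R := R) hd ho h3 hb
          rw [← h0]
          exact pinnedCount_congr _ _ _ _ (fun y w => rfl)
        · have h0 := pinnedCount_blockTransfer_o (R := R) hd ho h3 hb
          rw [← h0]
          exact pinnedCount_congr _ _ _ _ (fun y w => by unfold covW Fc; ring)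
      rw [hzero']; ring
  have hsum : (∑ x : Config E, if (∀ e, e ∉ F → x e = z e) then
      pinnedCount (specFree F τ x) (specPin F z τ x) (Dc ends o a₁ a₂ a₃ b x : Config E → Config E → R) else 0) = (0 : R) := by
    refine Finset.sum_eq_zero fun x _ => ?_
    split_ifs with hx
    · exact hzero x hx
    · rfl
  rw [hsum] at h2
  have h2' : (2 : R) ≠ 0 := by norm_num
  exact (mul_eq_zero.mp h2).resolve_left h2'

end Bridge

end LocusBridge

end CovForm

end Summit.Ventures.PercRepro2
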